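import Summits.NavierStokesRegularity.FunctionalMining.HsEnergyBalance
import HarnessLib

/-!
# FunctionalMining — inequalities for the homogeneous Sobolev energies `E_s` (family `EF.s`)

Search for candidate a priori estimates; no regularity claim. Cell `pub-nsfunc`, prove seat
(gen 11). Lattice-side tools for the static half of the rows `EF.s | T_LD | G1` (SIEVELD §3.6): with
`E_s(v) = ∑_k σ_s(k) ‖v̂(k)‖²`, `σ_s(k) = (4π²|k|²)^s` (`torusHsEnergy_eq_tsum`),

* the symbol sum `hsSymbolSum σ w = ∑_k σ_σ(k) ‖ŵ(k)‖²` at ANY real order (`= E_σ(w)` for `σ ≥ 0` and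
  smooth `w`), summable for smooth `w` (`summable_hsSymbolSum_term`);
* **monotonicity in the order** `E_s(v) ≤ E_{s'}(v)` for `0 < s ≤ s'` (integer frequencies:
  `σ_s(k) ≤ σ_{s'}(k)` since `4π²|k|² ≥ 1` off `k = 0`);
* **interpolation** `E_{(1−θ)s₀+θs₁} ≤ E_{s₀}^{1−θ} E_{s₁}^{θ}` (Hölder on the lattice);
* **the pairing bound** `|∫⟪(-Δ)^s u, w⟫| ≤ E_{s+1}(u)^{1/2} · (hsSymbolSum (s−1) w)^{1/2}`
  (Parseval form of the pairing, `σ_s = σ_{s+1}^{1/2} σ_{s−1}^{1/2}`, Cauchy–Schwarz on the lattice), hence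
  `|N_s(u)| ≤ 2 E_{s+1}(u)^{1/2} ‖(u·∇)u‖_{Ḣ^{s−1}}` — the first step of the expected proof of the
  static production estimate (`HsProductionBound`, file `HsSaturatingLawReduction`); the remaining step is a lattice product law `Ḣ^{s₁}·Ḣ^{s₂} ⊂ Ḣ^{s₁+s₂−3/2}`
  (tree: only `(1,1) ↦ 1/2`, `TorusLatticeProductLaw`).

All statements are Fourier-side folklore (Grafakos 2014 §3.2–3.3) over the tree's `Torus.fracLaplacian`.
-/

noncomputable section

open MeasureTheory Set Filter Topology Function UnitAddTorus
open scoped InnerProductSpace RealInnerProductSpace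

namespace Summit.NavierStokesRegularity.FunctionalMining

open Literature.Analysis Literature.Analysis.FunctionSpaces Literature.Analysis.FluidPDE
open Literature.Analysis.FunctionSpaces.Torus Literature.Analysis.FluidPDE.Torus

variable {d : Type*} [Fintype d] [DecidableEq d]

/-! ## 1. The symbol sum at any real order -/

/-- **The symbol sum `∑_k (4π²|k|²)^σ ‖ŵ(k)‖²`** at any real order `σ` (`= E_σ(w)` for `σ ≥ 0` and
smooth `w`; for `σ < 0` the zero mode carries the weight `0^σ = 0`, i.e. the sum is the homogeneous
`Ḣ^σ` energy of the mean-free part). [ours; packaging] -/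
def hsSymbolSum (σ : ℝ) (w : UnitAddTorus d → EuclideanSpace ℝ d) : ℝ :=
  ∑' k : d → ℤ, fracSymbol σ k * ‖mFourierCoeff (EuclideanSpace.complexify ∘ w) k‖ ^ 2

/-- `hsSymbolSum σ w = E_σ(w)` for `σ ≥ 0` and smooth `w`. [folklore] -/
theorem hsSymbolSum_eq_torusHsEnergy {σ : ℝ} (hσ : 0 ≤ σ) {w : UnitAddTorus d → EuclideanSpace ℝ d}
    (hw : IsSmooth w) : hsSymbolSum σ w = torusHsEnergy σ w := by
  rw [hsSymbolSum, torusHsEnergy_eq_tsum hσ hw]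

omit [DecidableEq d] in
/-- Off the zero mode the symbol is at least `1` at order `0 ≤ σ`… more precisely
`σ_σ(k) ≤ σ_{σ'}(k)` for `σ ≤ σ'` and `k ≠ 0` (`4π²|k|² ≥ 1`), and `σ_σ(0) = 0 ≤ σ_{σ'}(0)` for
`σ, σ' > 0`. [folklore] -/
theorem fracSymbol_mono {σ σ' : ℝ} (hσ : 0 < σ) (hσσ' : σ ≤ σ') (k : d → ℤ) :
    fracSymbol σ k ≤ fracSymbol σ' k := by
  by_cases hk : k = 0
  · subst hk
    rw [fracSymbol_zero hσ.ne', fracSymbol_zero (by linarith : σ' ≠ 0)]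
  · have h1 : 1 ≤ 4 * Real.pi ^ 2 * freqNormSq k := by
      have hk1 := one_le_freqNormSq_of_ne_zero hk
      have hπ : (1 : ℝ) ≤ 4 * Real.pi ^ 2 := by
        have := Real.pi_gt_three; nlinarith
      nlinarith
    unfold fracSymbol
    exact Real.rpow_le_rpow_of_exponent_le h1 hσσ'

/-- For smooth `w` the terms `σ_σ(k)‖ŵ(k)‖²` are summable at every real order `σ`. [folklore] -/
theorem summable_hsSymbolSum_term (σ : ℝ) {w : UnitAddTorus d → EuclideanSpace ℝ d} (hw : IsSmooth w) :
    Summable fun k : d → ℤ => fracSymbol σ k * ‖mFourierCoeff (EuclideanSpace.complexify ∘ w) k‖ ^ 2 := by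
  -- majorant `B σ_τ(k)‖ŵ(k)‖ + ‖ŵ(k)‖²` with `τ = max σ 1 ≥ 0` (`σ_σ ≤ σ_τ + 1`), `B = sup ‖w‖`
  set τ : ℝ := max σ 1 with hτ
  have hτ0 : 0 ≤ τ := le_trans zero_le_one (le_max_right _ _)
  obtain ⟨B, hB⟩ := (isCompact_univ.image hw.continuous).isBounded.exists_norm_le
  have hB' : ∀ x, ‖(EuclideanSpace.complexify ∘ w) x‖ ≤ B := fun x => by
    rw [Function.comp_apply, LinearIsometry.norm_map]
    exact hB _ ⟨x, mem_univ _, rfl⟩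
  have hcoef : ∀ k, ‖mFourierCoeff (EuclideanSpace.complexify ∘ w) k‖ ≤ B :=
    fun k => norm_mFourierCoeff_le_of_forall_norm_le hB' k
  have hB0 : 0 ≤ B := (norm_nonneg _).trans (hcoef 0)
  have hwc : Continuous (EuclideanSpace.complexify ∘ w) :=
    EuclideanSpace.complexify.continuous.comp hw.continuous
  have hsum : Summable fun k : d → ℤ => B * (fracSymbol τ k * ‖mFourierCoeff (EuclideanSpace.complexify ∘ w) k‖) +
      ‖mFourierCoeff (EuclideanSpace.complexify ∘ w) k‖ ^ 2 :=
    ((summable_fracSymbol_mul_norm hτ0 hw).mul_left B).add (hasSum_sq_mFourierCoeff_euclidean hwc).summable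
  refine Summable.of_nonneg_of_le (fun k => mul_nonneg (fracSymbol_nonneg σ k) (sq_nonneg _))
    (fun k => ?_) hsum
  have hle : fracSymbol σ k ≤ fracSymbol τ k + 1 := by
    by_cases hk : k = 0
    · subst hk
      have h0 : fracSymbol σ (0 : d → ℤ) ≤ 1 := by
        unfold fracSymbol
        rw [freqNormSq_zero, mul_zero]
        exact Real.zero_rpow_le_one σ
      linarith [fracSymbol_nonneg τ (0 : d → ℤ)]
    · have h1 : 1 ≤ 4 * Real.pi ^ 2 * freqNormSq k := by
        have hk1 := one_le_freqNormSq_of_ne_zero hk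
        have hπ : (1 : ℝ) ≤ 4 * Real.pi ^ 2 := by
          have := Real.pi_gt_three; nlinarith
        nlinarith
      have h2 : fracSymbol σ k ≤ fracSymbol τ k := by
        unfold fracSymbol
        exact Real.rpow_le_rpow_of_exponent_le h1 (le_max_left _ _)
      linarith
  set c := ‖mFourierCoeff (EuclideanSpace.complexify ∘ w) k‖ with hc
  have hc0 : 0 ≤ c := norm_nonneg _
  calc fracSymbol σ k * c ^ 2 ≤ (fracSymbol τ k + 1) * c ^ 2 :=
        mul_le_mul_of_nonneg_right hle (sq_nonneg _)
    _ = fracSymbol τ k * c * c + c ^ 2 := by ring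
    _ ≤ fracSymbol τ k * c * B + c ^ 2 := by
        have := mul_le_mul_of_nonneg_left (hcoef k) (mul_nonneg (fracSymbol_nonneg τ k) hc0)
        linarith
    _ = B * (fracSymbol τ k * c) + c ^ 2 := by ring

omit [DecidableEq d] in
/-- `hsSymbolSum σ w ≥ 0`. [folklore] -/
theorem hsSymbolSum_nonneg (σ : ℝ) (w : UnitAddTorus d → EuclideanSpace ℝ d) : 0 ≤ hsSymbolSum σ w :=
  tsum_nonneg fun k => mul_nonneg (fracSymbol_nonneg σ k) (sq_nonneg _)

/-! ## 2. Monotonicity and interpolation in the order -/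

/-- **Monotonicity**: `E_s(v) ≤ E_{s'}(v)` for `0 < s ≤ s'` and smooth `v` (integer frequencies).
[folklore] -/
theorem torusHsEnergy_mono {s s' : ℝ} (hs : 0 < s) (hss' : s ≤ s')
    {v : UnitAddTorus d → EuclideanSpace ℝ d} (hv : IsSmooth v) :
    torusHsEnergy s v ≤ torusHsEnergy s' v := by
  rw [torusHsEnergy_eq_tsum hs.le hv, torusHsEnergy_eq_tsum (by linarith) hv]
  exact Summable.tsum_le_tsum (fun k => mul_le_mul_of_nonneg_right (fracSymbol_mono hs hss' k) (sq_nonneg _))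
    (summable_hsSymbolSum_term s hv) (summable_hsSymbolSum_term s' hv)

/-- **Interpolation (log-convexity in the order)**: for `0 ≤ s₀`, `0 ≤ s₁`, `0 < θ < 1` and smooth `v`,
`E_{(1−θ)s₀+θs₁}(v) ≤ E_{s₀}(v)^{1−θ} E_{s₁}(v)^{θ}` (Hölder on the lattice with exponents
`1/(1−θ)`, `1/θ`). [folklore] -/
theorem torusHsEnergy_interpolation {s₀ s₁ θ : ℝ} (hs₀ : 0 ≤ s₀) (hs₁ : 0 ≤ s₁) (hθ0 : 0 < θ)
    (hθ1 : θ < 1) {v : UnitAddTorus d → EuclideanSpace ℝ d} (hv : IsSmooth v) :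
    torusHsEnergy ((1 - θ) * s₀ + θ * s₁) v ≤
      torusHsEnergy s₀ v ^ (1 - θ) * torusHsEnergy s₁ v ^ θ := by
  have hsθ : 0 ≤ (1 - θ) * s₀ + θ * s₁ := by nlinarith
  have h1θ : 0 < 1 - θ := by linarith
  set c : (d → ℤ) → ℝ := fun k => ‖mFourierCoeff (EuclideanSpace.complexify ∘ v) k‖ ^ 2 with hc
  have hc0 : ∀ k, 0 ≤ c k := fun k => sq_nonneg _
  rw [torusHsEnergy_eq_tsum hsθ hv, torusHsEnergy_eq_tsum hs₀ hv, torusHsEnergy_eq_tsum hs₁ hv]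
  -- Hölder with `f_k = (σ_{s₀} c)^{1−θ}`, `g_k = (σ_{s₁} c)^{θ}`
  set f : (d → ℤ) → ℝ := fun k => (fracSymbol s₀ k * c k) ^ (1 - θ) with hf
  set g : (d → ℤ) → ℝ := fun k => (fracSymbol s₁ k * c k) ^ θ with hg
  have hf0 : ∀ k, 0 ≤ f k := fun k => Real.rpow_nonneg (mul_nonneg (fracSymbol_nonneg _ _) (hc0 k)) _
  have hg0 : ∀ k, 0 ≤ g k := fun k => Real.rpow_nonneg (mul_nonneg (fracSymbol_nonneg _ _) (hc0 k)) _
  have hpq : (1 / (1 - θ)).HolderConjugate (1 / θ) := Real.holderConjugate_one_div h1θ hθ0 (by ring)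
  have hfp : ∀ k, f k ^ (1 / (1 - θ)) = fracSymbol s₀ k * c k := by
    intro k
    rw [hf, ← Real.rpow_mul (mul_nonneg (fracSymbol_nonneg _ _) (hc0 k)),
      mul_one_div_cancel h1θ.ne', Real.rpow_one]
  have hgq : ∀ k, g k ^ (1 / θ) = fracSymbol s₁ k * c k := by
    intro k
    rw [hg, ← Real.rpow_mul (mul_nonneg (fracSymbol_nonneg _ _) (hc0 k)),
      mul_one_div_cancel hθ0.ne', Real.rpow_one]
  have hfs : Summable fun k => f k ^ (1 / (1 - θ)) := by
    simp_rw [hfp]; exact summable_hsSymbolSum_term s₀ hv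
  have hgs : Summable fun k => g k ^ (1 / θ) := by
    simp_rw [hgq]; exact summable_hsSymbolSum_term s₁ hv
  have hH := Real.inner_le_Lp_mul_Lq_tsum_of_nonneg hpq hf0 hg0 hfs hgs
  simp_rw [hfp, hgq, one_div_one_div] at hH
  -- the termwise identity `σ_{(1−θ)s₀+θs₁} c = f g`
  have hterm : ∀ k, fracSymbol ((1 - θ) * s₀ + θ * s₁) k * c k = f k * g k := by
    intro k
    have hx : 0 ≤ 4 * Real.pi ^ 2 * freqNormSq k := by
      have := freqNormSq_nonneg k; positivity
    show fracSymbol ((1 - θ) * s₀ + θ * s₁) k * c k =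
      (fracSymbol s₀ k * c k) ^ (1 - θ) * (fracSymbol s₁ k * c k) ^ θ
    rw [Real.mul_rpow (fracSymbol_nonneg _ _) (hc0 k), Real.mul_rpow (fracSymbol_nonneg _ _) (hc0 k)]
    unfold fracSymbol
    rw [← Real.rpow_mul hx, ← Real.rpow_mul hx]
    have hcpow : c k = c k ^ (1 - θ) * c k ^ θ := by
      rw [← Real.rpow_add' (hc0 k) (by linarith)]; norm_num
    have hσpow : (4 * Real.pi ^ 2 * freqNormSq k) ^ ((1 - θ) * s₀ + θ * s₁) =
        (4 * Real.pi ^ 2 * freqNormSq k) ^ (s₀ * (1 - θ)) * (4 * Real.pi ^ 2 * freqNormSq k) ^ (s₁ * θ) := by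
      rw [← Real.rpow_add_of_nonneg hx (by nlinarith) (by nlinarith)]
      congr 1; ring
    rw [hσpow]
    conv_lhs => rw [hcpow]
    ring
  calc ∑' k, fracSymbol ((1 - θ) * s₀ + θ * s₁) k * c k = ∑' k, f k * g k := tsum_congr hterm
    _ ≤ _ := hH

/-! ## 3. The pairing bound -/

omit [DecidableEq d] in
/-- `σ_s(k) = σ_{s+1}(k)^{1/2} σ_{s−1}(k)^{1/2}` for `s > 0` (at `k = 0` both sides vanish). [folklore] -/
theorem fracSymbol_eq_sqrt_mul_sqrt {s : ℝ} (hs : 0 < s) (k : d → ℤ) :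
    fracSymbol s k = Real.sqrt (fracSymbol (s + 1) k) * Real.sqrt (fracSymbol (s - 1) k) := by
  have hx : 0 ≤ 4 * Real.pi ^ 2 * freqNormSq k := by
    have := freqNormSq_nonneg k; positivity
  unfold fracSymbol
  rw [Real.sqrt_eq_rpow, Real.sqrt_eq_rpow, ← Real.rpow_mul hx, ← Real.rpow_mul hx]
  by_cases hk : k = 0
  · subst hk
    rw [freqNormSq_zero, mul_zero, Real.zero_rpow hs.ne', Real.zero_rpow (by positivity), zero_mul]
  · have hpos : 0 < 4 * Real.pi ^ 2 * freqNormSq k := by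
      have := one_le_freqNormSq_of_ne_zero hk; positivity
    rw [← Real.rpow_add hpos]
    congr 1; ring

/-- **The pairing bound**: for smooth `u, w` on `T^d` and `s > 0`,
`|∫⟪(-Δ)^s u, w⟫| ≤ E_{s+1}(u)^{1/2} · (∑_k σ_{s−1}(k)‖ŵ(k)‖²)^{1/2}` (Parseval form of the pairing,
`σ_s = σ_{s+1}^{1/2}σ_{s−1}^{1/2}`, Cauchy–Schwarz on the lattice). [folklore] -/
theorem abs_integral_inner_fracLaplacian_le {s : ℝ} (hs : 0 < s)
    {u w : UnitAddTorus d → EuclideanSpace ℝ d} (hu : IsSmooth u) (hw : IsSmooth w) :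
    |∫ x, ⟪fracLaplacian s u x, w x⟫_ℝ| ≤
      Real.sqrt (torusHsEnergy (s + 1) u) * Real.sqrt (hsSymbolSum (s - 1) w) := by
  set a : (d → ℤ) → ℝ := fun k => ‖mFourierCoeff (EuclideanSpace.complexify ∘ u) k‖ with ha
  set b : (d → ℤ) → ℝ := fun k => ‖mFourierCoeff (EuclideanSpace.complexify ∘ w) k‖ with hb
  have ha0 : ∀ k, 0 ≤ a k := fun k => norm_nonneg _
  have hb0 : ∀ k, 0 ≤ b k := fun k => norm_nonneg _
  rw [integral_inner_fracLaplacian_comm hs.le hu hw]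
  have hP : ∫ x, ⟪u x, fracLaplacian s w x⟫_ℝ = ∫ x, ⟪w x, fracLaplacian s u x⟫_ℝ := by
    rw [← integral_inner_fracLaplacian_comm hs.le hu hw]
    exact integral_congr_ae (ae_of_all _ fun x => real_inner_comm _ _)
  rw [hP, integral_inner_fracLaplacian_eq_tsum hs.le hu hw.continuous]
  -- Cauchy–Schwarz with `f = σ_{s+1}^{1/2} a`, `g = σ_{s−1}^{1/2} b`
  set f : (d → ℤ) → ℝ := fun k => Real.sqrt (fracSymbol (s + 1) k) * a k with hf
  set g : (d → ℤ) → ℝ := fun k => Real.sqrt (fracSymbol (s - 1) k) * b k with hg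
  have hf0 : ∀ k, 0 ≤ f k := fun k => mul_nonneg (Real.sqrt_nonneg _) (ha0 k)
  have hg0 : ∀ k, 0 ≤ g k := fun k => mul_nonneg (Real.sqrt_nonneg _) (hb0 k)
  have hf2 : ∀ k, f k ^ (2 : ℝ) = fracSymbol (s + 1) k * a k ^ 2 := by
    intro k
    rw [Real.rpow_two, hf, mul_pow, Real.sq_sqrt (fracSymbol_nonneg _ _)]
  have hg2 : ∀ k, g k ^ (2 : ℝ) = fracSymbol (s - 1) k * b k ^ 2 := by
    intro k
    rw [Real.rpow_two, hg, mul_pow, Real.sq_sqrt (fracSymbol_nonneg _ _)]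
  have hfs : Summable fun k => f k ^ (2 : ℝ) := by
    simp_rw [hf2]; exact summable_hsSymbolSum_term (s + 1) hu
  have hgs : Summable fun k => g k ^ (2 : ℝ) := by
    simp_rw [hg2]; exact summable_hsSymbolSum_term (s - 1) hw
  have hCS := Real.inner_le_Lp_mul_Lq_tsum_of_nonneg Real.HolderConjugate.two_two hf0 hg0 hfs hgs
  simp_rw [hf2, hg2] at hCS
  rw [← Real.sqrt_eq_rpow, ← Real.sqrt_eq_rpow, ← torusHsEnergy_eq_tsum (by linarith) hu] at hCS
  -- termwise: `|σ_s Re⟪ŵ, û⟫| ≤ f g`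
  have hterm : ∀ k, |fracSymbol s k * (⟪mFourierCoeff (EuclideanSpace.complexify ∘ w) k,
      mFourierCoeff (EuclideanSpace.complexify ∘ u) k⟫_ℂ).re| ≤ f k * g k := by
    intro k
    rw [abs_mul, abs_of_nonneg (fracSymbol_nonneg s k), fracSymbol_eq_sqrt_mul_sqrt hs k]
    have h1 : |(⟪mFourierCoeff (EuclideanSpace.complexify ∘ w) k,
        mFourierCoeff (EuclideanSpace.complexify ∘ u) k⟫_ℂ).re| ≤ b k * a k :=
      (Complex.abs_re_le_norm _).trans (norm_inner_le_norm _ _)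
    calc Real.sqrt (fracSymbol (s + 1) k) * Real.sqrt (fracSymbol (s - 1) k) *
          |(⟪mFourierCoeff (EuclideanSpace.complexify ∘ w) k,
            mFourierCoeff (EuclideanSpace.complexify ∘ u) k⟫_ℂ).re|
        ≤ Real.sqrt (fracSymbol (s + 1) k) * Real.sqrt (fracSymbol (s - 1) k) * (b k * a k) :=
          mul_le_mul_of_nonneg_left h1 (mul_nonneg (Real.sqrt_nonneg _) (Real.sqrt_nonneg _))
      _ = f k * g k := by rw [hf, hg]; ring
  have hsumfg : Summable fun k => f k * g k :=
    (Real.summable_and_inner_le_Lp_mul_Lq_tsum_of_nonneg Real.HolderConjugate.two_two hf0 hg0 hfs hgs).1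
  calc |∑' k, fracSymbol s k * (⟪mFourierCoeff (EuclideanSpace.complexify ∘ w) k,
        mFourierCoeff (EuclideanSpace.complexify ∘ u) k⟫_ℂ).re|
      ≤ ∑' k, |fracSymbol s k * (⟪mFourierCoeff (EuclideanSpace.complexify ∘ w) k,
          mFourierCoeff (EuclideanSpace.complexify ∘ u) k⟫_ℂ).re| := by
        have := norm_tsum_le_tsum_norm (f := fun k => fracSymbol s k *
          (⟪mFourierCoeff (EuclideanSpace.complexify ∘ w) k,
            mFourierCoeff (EuclideanSpace.complexify ∘ u) k⟫_ℂ).re)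
          ((hsumfg.of_nonneg_of_le (fun k => abs_nonneg _) hterm).congr fun k => (Real.norm_eq_abs _).symm)
        simpa only [Real.norm_eq_abs] using this
    _ ≤ ∑' k, f k * g k := Summable.tsum_le_tsum hterm (hsumfg.of_nonneg_of_le (fun k => abs_nonneg _) hterm) hsumfg
    _ ≤ Real.sqrt (torusHsEnergy (s + 1) u) * Real.sqrt (∑' k, fracSymbol (s - 1) k * b k ^ 2) := hCS

/-- **First step of the static half**: `|N_s(u)| ≤ 2 E_{s+1}(u)^{1/2} · (hsSymbolSum (s−1) ((u·∇)u))^{1/2}`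
(`= 2‖u‖_{Ḣ^{s+1}} ‖(u·∇)u‖_{Ḣ^{s−1}}`) for smooth `u` on `T^d`, `s > 0`. The remaining step towards
`HsProductionBound` is a lattice product law for `‖(u·∇)u‖_{Ḣ^{s−1}}`. [ours] -/
theorem abs_hsInertialRate_le {s : ℝ} (hs : 0 < s) {u : UnitAddTorus d → EuclideanSpace ℝ d}
    (hu : IsSmooth u) :
    |hsInertialRate s u| ≤ 2 * Real.sqrt (torusHsEnergy (s + 1) u) *
      Real.sqrt (hsSymbolSum (s - 1) (Torus.convect u u)) := by
  unfold hsInertialRate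
  rw [abs_mul, abs_neg, abs_two, mul_assoc]
  exact mul_le_mul_of_nonneg_left (abs_integral_inner_fracLaplacian_le hs hu (hu.convect hu)) (by norm_num)

end Summit.NavierStokesRegularity.FunctionalMining
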